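import Summits.QuantumFields.YangMills.Theorems.UnitScaleTiltProp7LapCombRegroup
import HarnessLib

/-!
# Route `UnitScaleTilt`, crux K1 «MinimiserStabilityRegPr» (stmt-QuantumFields-19200), route-R E′, S3 K-form engine, ROW (H) — hLap INHABITANT, FILE G (ℤ^d counts):
# COUNTING THE SITE FAMILIES OVER A BOX OF COMBS — the site-indexed sums of ✓ `Prop7LapCombSites` (run `κ`, position `j` on the comb `Γ(0,v)`) ARE the rung sums of the
# full comb word, so px9's count ✓ `Prop7CombLadderCount.sum_box_sum_rungs_le` (determined set `∅`) applies: `Σ_(v∈box) Σ_κ Σ_(j<|v κ|) f(p_(κ,j), l_(κ,j)) ≤ Σ_(i<d) (2R+1)^(d−i)·Σ_(q∈box)(f(q,(κ_i,+)) + f(q,(κ_i,−)))`,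
# and Cauchy–Schwarz puts the path length `Σ_κ|v κ| ≤ d·R` in front of the squares — the last run (the CURRENT sites) carries `(2R+1)·d·R` = the HARDY ℓ² of the LOCATE, explicit

Cell `ym3-torus`, width seat `ym3-torus-px4` (gen 4); ★ym-ust-19200-p1 g16 NAMER WORD 14 «px4 g4: hLap INHABITANT GO» (2026-08-29 00:17Z), road (iii).  THEOREMS ONLY (0 `def`,
0 `sorry`); `--supports stmt-QuantumFields-19200`, count-neutral.  YM₃ on T³ is a ladder rung (R3), not the Clay problem; nothing here claims hLap, hRes, (H), S3, E′, a stub,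
the crux, d = 4 or the mass gap.

WHAT IS PROVED (ns `…Theorems.Prop7LapCombSitesCount`; splits `hsplit : ∀ μ, (finRange d).reverse = s μ ++ μ :: t μ`; box `[−R,R]^d` inline; `κ_i = ((finRange d).reverse)[i]`).
* §1 `fst_getD_seg` (the letter of the `j`-th point of the `κ`-run has direction `κ`), `take_finRange_reverse_eq_split` (`(finRange d).reverse ↾ i = s κ_i`),
  ★ `sum_sites_eq_sum_rungs_treeWord` (the site double sum = the rung sum of `Γ(v) = treeWord v`, base `0`), `sum_natAbs_le` (`Σ_κ|v κ| ≤ d·R` on the box).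
* §2 ★★★ `sum_box_sum_sites_le` (the title count, any `f ≥ 0` of (point, letter)), ★★ `sum_box_sq_sum_sites_le` (Cauchy–Schwarz form: `Σ_(v∈box)(Σ_κΣ_j g)² ≤ d·R·Σ_i (2R+1)^(d−i) Σ_q (g² + g²)`).
HONEST SCOPE.  Counting only; the weights are px9's crude ones (`(2R+1)^(d−i)`: last run `2R+1`, run `i` free in the later coordinates); no T³, no booking.

References: T. Bałaban, CMP 98 (1985) 17–51 [Balaban1985Averaging] ((8)–(9) pp.18–19, p.24); CMP 102 (1985) 255–275 [Balaban1985UV3] ((27) p.263).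
-/

set_option autoImplicit false

noncomputable section

open scoped BigOperators

namespace Summit.QuantumFields.YangMills.Theorems.Prop7LapCombSitesCount

open Literature.MathematicalPhysics.QuantumFieldTheory.Balaban1983to89
open B7Prop1Explicit (Site Letter e disp seg treeWord disp_append length_seg)
open Summit.QuantumFields.YangMills.Theorems.Prop7CombLadderCount (sum_box_sum_rungs_le split_nodup getD_seg)
open Summit.QuantumFields.YangMills.Theorems.Prop7LapCombRegroup (split_unique sum_rungs_flatMap sum_range_getD_eq_sum_toFinset)

variable {d : ℕ}

/-! ## §1 The site double sum is the rung sum of the full comb -/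

section Reindex

/-- the `j`-th letter of the run `seg κ n` (for `j < |n|`) has direction `κ`. [folklore] -/
theorem fst_getD_seg (κ : Fin d) (n : ℤ) (j : ℕ) (hj : j < n.natAbs) (dflt : Letter d) : ((seg κ n).getD j dflt).1 = κ := by
  rcases getD_seg κ n j hj dflt with h | h <;> rw [h]

variable (s t : Fin d → List (Fin d)) (hsplit : ∀ μ, (List.finRange d).reverse = s μ ++ μ :: t μ)

include hsplit in
/-- the comb prefix of the `i`-th direction: `(finRange d).reverse ↾ i = s κ_i`, `κ_i = ((finRange d).reverse)[i]`. [folklore] -/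
theorem take_finRange_reverse_eq_split (κ₀ : Fin d) (i : ℕ) (hi : i < (List.finRange d).reverse.length) :
    (List.finRange d).reverse.take i = s ((List.finRange d).reverse.getD i κ₀) := by
  set L := (List.finRange d).reverse with hL
  have hnd : (s (L.getD i κ₀) ++ L.getD i κ₀ :: t (L.getD i κ₀)).Nodup := (hsplit _) ▸ List.nodup_reverse.mpr (List.nodup_finRange d)
  have hu : L = L.take i ++ L.getD i κ₀ :: L.drop (i + 1) := by
    rw [List.getD_eq_getElem _ _ hi, ← List.drop_eq_getElem_cons hi, List.take_append_drop]
  exact ((split_unique (s (L.getD i κ₀)) (L.take i) hnd ((hsplit _).symm.trans hu)).1).symm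

include hsplit in
/-- ★ **THE SITE DOUBLE SUM IS THE RUNG SUM OF THE FULL COMB**: for `F : Site d → Letter d → M`,
`Σ_κ Σ_(j<|v κ|) F(disp((s κ).flatMap run) + disp((seg κ (v κ))↾j), (seg κ (v κ))[j]) = Σ_(k<|Γ(v)|) F(disp(Γ(v)↾k), Γ(v)[k])`, `Γ(v) = treeWord v`. [cite: Balaban1985Averaging, (8)-(9) pp.18-19] -/
theorem sum_sites_eq_sum_rungs_treeWord {M : Type*} [AddCommMonoid M] (F : Site d → Letter d → M) (dflt : Letter d) (κ₀ : Fin d) (v : Site d) :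
    ∑ κ : Fin d, ∑ j ∈ Finset.range (v κ).natAbs, F (disp ((s κ).flatMap (fun ν => seg ν (v ν))) + disp ((seg κ (v κ)).take j)) ((seg κ (v κ)).getD j dflt)
      = ∑ k ∈ Finset.range (treeWord v).length, F (disp ((treeWord v).take k)) ((treeWord v).getD k dflt) := by
  classical
  have hL : treeWord v = (List.finRange d).reverse.flatMap (fun κ => seg κ (v κ)) := rfl
  have hnd : (List.finRange d).reverse.Nodup := List.nodup_reverse.mpr (List.nodup_finRange d)
  have h := sum_rungs_flatMap F dflt κ₀ v (List.finRange d).reverse 0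
  simp only [zero_add] at h
  rw [hL, h]
  set G : Fin d → M := fun κ => ∑ j ∈ Finset.range (v κ).natAbs,
      F (disp ((s κ).flatMap (fun ν => seg ν (v ν))) + disp ((seg κ (v κ)).take j)) ((seg κ (v κ)).getD j dflt) with hG
  have h2 : ∑ i ∈ Finset.range (List.finRange d).reverse.length, ∑ j ∈ Finset.range (v ((List.finRange d).reverse.getD i κ₀)).natAbs,
        F (disp (((List.finRange d).reverse.take i).flatMap (fun κ => seg κ (v κ))) + disp ((seg ((List.finRange d).reverse.getD i κ₀) (v ((List.finRange d).reverse.getD i κ₀))).take j))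
          ((seg ((List.finRange d).reverse.getD i κ₀) (v ((List.finRange d).reverse.getD i κ₀))).getD j dflt)
      = ∑ i ∈ Finset.range (List.finRange d).reverse.length, G ((List.finRange d).reverse.getD i κ₀) :=
    Finset.sum_congr rfl fun i hi => by rw [take_finRange_reverse_eq_split s t hsplit κ₀ i (Finset.mem_range.mp hi)]
  rw [h2, sum_range_getD_eq_sum_toFinset G κ₀ _ hnd]
  have huniv : (List.finRange d).reverse.toFinset = Finset.univ := by ext κ; simp
  rw [huniv]

end Reindex

/-! ## §2 The box count and its Cauchy–Schwarz form -/

section Count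

variable (s t : Fin d → List (Fin d)) (hsplit : ∀ μ, (List.finRange d).reverse = s μ ++ μ :: t μ)

/-- the path length on the box: `Σ_κ |v κ| ≤ d·R` for `v ∈ [−R,R]^d`. [cite: Balaban1985Averaging, p.24] -/
theorem sum_natAbs_le (R : ℕ) (v : Site d) (hv : v ∈ Fintype.piFinset fun _ : Fin d => Finset.Icc (-(R : ℤ)) (R : ℤ)) :
    ∑ κ : Fin d, (v κ).natAbs ≤ d * R := by
  have hb : ∀ κ, (v κ).natAbs ≤ R := fun κ => by have h := Finset.mem_Icc.mp (Fintype.mem_piFinset.mp hv κ); omega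
  calc ∑ κ : Fin d, (v κ).natAbs ≤ ∑ _κ : Fin d, R := Finset.sum_le_sum fun κ _ => hb κ
    _ = d * R := by rw [Finset.sum_const, Finset.card_univ, Fintype.card_fin, smul_eq_mul]

/-- the length of the full comb is the path length. [folklore] -/
theorem length_treeWord (v : Site d) : (treeWord v).length = ∑ κ : Fin d, (v κ).natAbs := by
  have h1 : (treeWord v).length = (((List.finRange d).reverse).map fun κ => (v κ).natAbs).sum := by
    show (((List.finRange d).reverse).flatMap (fun κ => seg κ (v κ))).length = _
    exact Prop7CombLadderCount.length_flatMap_seg _ v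
  rw [h1, ← List.sum_toFinset _ (List.nodup_reverse.mpr (List.nodup_finRange d))]
  refine Finset.sum_congr ?_ fun _ _ => rfl
  ext κ; simp

include hsplit in
/-- ★★★ **THE BOX COUNT OF A SITE FAMILY**: for every nonnegative `f` of (point, letter),
`Σ_(v∈[−R,R]^d) Σ_κ Σ_(j<|v κ|) f(p_(κ,j)(v), l_(κ,j)(v)) ≤ Σ_(i<d) (2R+1)^(d−i)·Σ_(q∈box)(f(q,(κ_i,+)) + f(q,(κ_i,−)))`, `κ_i = ((finRange d).reverse)[i]` — every (point, letter) of
the `i`-th run is met by at most `(2R+1)^(d−i)` combs of the box (px9's ✓ `sum_box_sum_rungs_le` at the empty determined set).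
[cite: Balaban1985Averaging, (8)-(9) pp.18-19, p.24; Balaban1985UV3, (27) p.263] -/
theorem sum_box_sum_sites_le (R : ℕ) (dflt : Letter d) (κ₀ : Fin d) (f : Site d → Letter d → ℝ) (hf : ∀ q b, 0 ≤ f q b) :
    ∑ v ∈ Fintype.piFinset (fun _ : Fin d => Finset.Icc (-(R : ℤ)) (R : ℤ)),
        ∑ κ : Fin d, ∑ j ∈ Finset.range (v κ).natAbs, f (disp ((s κ).flatMap (fun ν => seg ν (v ν))) + disp ((seg κ (v κ)).take j)) ((seg κ (v κ)).getD j dflt)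
      ≤ ∑ i ∈ Finset.range d, (((2 * R + 1) ^ (d - i) : ℕ) : ℝ)
          * ∑ q ∈ Fintype.piFinset (fun _ : Fin d => Finset.Icc (-(R : ℤ)) (R : ℤ)), (f q ((List.finRange d).reverse.getD i κ₀, true) + f q ((List.finRange d).reverse.getD i κ₀, false)) := by
  classical
  have hnd : (List.finRange d).reverse.Nodup := List.nodup_reverse.mpr (List.nodup_finRange d)
  have hcount := sum_box_sum_rungs_le R dflt κ₀ f hf (List.finRange d).reverse ∅ hnd (fun κ _ => Finset.notMem_empty κ)
  simp only [Finset.sum_empty, zero_add, Finset.card_empty, List.length_reverse, List.length_finRange] at hcount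
  refine (le_of_eq ?_).trans hcount
  refine Finset.sum_congr rfl fun v _ => ?_
  rw [sum_sites_eq_sum_rungs_treeWord s t hsplit f dflt κ₀ v]
  rfl

include hsplit in
/-- ★★ **CAUCHY–SCHWARZ FORM**: for every real `g` of (point, letter),
`Σ_(v∈box) (Σ_κ Σ_(j<|v κ|) g(p_(κ,j), l_(κ,j)))² ≤ (d·R)·Σ_(i<d) (2R+1)^(d−i)·Σ_(q∈box)(g(q,(κ_i,+))² + g(q,(κ_i,−))²)` — the path length `≤ d·R` times the box count of `g²`.
[cite: Balaban1985Averaging, (19)-(20) p.21, p.24] -/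
theorem sum_box_sq_sum_sites_le (R : ℕ) (dflt : Letter d) (κ₀ : Fin d) (g : Site d → Letter d → ℝ) :
    ∑ v ∈ Fintype.piFinset (fun _ : Fin d => Finset.Icc (-(R : ℤ)) (R : ℤ)),
        (∑ κ : Fin d, ∑ j ∈ Finset.range (v κ).natAbs, g (disp ((s κ).flatMap (fun ν => seg ν (v ν))) + disp ((seg κ (v κ)).take j)) ((seg κ (v κ)).getD j dflt)) ^ 2
      ≤ ((d * R : ℕ) : ℝ) * ∑ i ∈ Finset.range d, (((2 * R + 1) ^ (d - i) : ℕ) : ℝ)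
          * ∑ q ∈ Fintype.piFinset (fun _ : Fin d => Finset.Icc (-(R : ℤ)) (R : ℤ)),
              (g q ((List.finRange d).reverse.getD i κ₀, true) ^ 2 + g q ((List.finRange d).reverse.getD i κ₀, false) ^ 2) := by
  classical
  -- per comb: `(Σ_sites g)² ≤ (#sites)·Σ_sites g²`, `#sites = Σ_κ|v κ| ≤ dR`
  have hper : ∀ v ∈ Fintype.piFinset (fun _ : Fin d => Finset.Icc (-(R : ℤ)) (R : ℤ)),
      (∑ κ : Fin d, ∑ j ∈ Finset.range (v κ).natAbs, g (disp ((s κ).flatMap (fun ν => seg ν (v ν))) + disp ((seg κ (v κ)).take j)) ((seg κ (v κ)).getD j dflt)) ^ 2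
        ≤ ((d * R : ℕ) : ℝ) * ∑ κ : Fin d, ∑ j ∈ Finset.range (v κ).natAbs,
            g (disp ((s κ).flatMap (fun ν => seg ν (v ν))) + disp ((seg κ (v κ)).take j)) ((seg κ (v κ)).getD j dflt) ^ 2 := by
    intro v hv
    rw [Finset.sum_sigma', Finset.sum_sigma']
    refine sq_sum_le_card_mul_sum_sq.trans (mul_le_mul_of_nonneg_right ?_ (Finset.sum_nonneg fun x _ => sq_nonneg _))
    rw [Finset.card_sigma]
    simp only [Finset.card_range]
    exact_mod_cast sum_natAbs_le R v hv
  refine (Finset.sum_le_sum hper).trans ?_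
  rw [← Finset.mul_sum]
  refine mul_le_mul_of_nonneg_left ?_ (by positivity)
  simpa only using sum_box_sum_sites_le s t hsplit R dflt κ₀ (fun q l => g q l ^ 2) (fun q b => sq_nonneg _)

end Count

end Summit.QuantumFields.YangMills.Theorems.Prop7LapCombSitesCount

end
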